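import Summits.QuantumAdvantage.QuantumAdvantage.Theorems.WbwVerifiableLineNoSpeedup.Negative.AdversaryDatum

/-!
# The adversary counts, I: uniform line formula, symmetry, total and row counts

Sequel to `AdversaryDatum.lean` (crux `WhiteBoxWalk.WbwVerifiableLineNoSpeedup`, stmt-QuantumAdvantage-2239,
work file `Disproof.lean` §7.1). The UNIFORM LINE FORMULA `line_formula`: if `σ` and
`σ * swap x_k v` (`k ≤ T`, `v ∉ {x_0,…,x_k}`) both have no return within `T` steps then
`x_{k+s}(σ * swap x_k v) = σ^s v` for `1 ≤ s ≤ T` (merge and split partners alike — the orbit of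
`v` cannot come back to `x_k`, or `x_k` would return to itself); symmetry of `Adj`; and the two
"crude" counts of §7.1: every end has at most `T · 2^m` partners, and at most `2^m + T` partners
changing a given row. Sorry-free.
-/

noncomputable section

set_option linter.dupNamespace false

namespace Summit.QuantumAdvantage.QuantumAdvantage.Theorems.WbwVerifiableLineNoSpeedup.Negative.Adversary

open Finset Literature.Computability.Cryptography Literature.Computability.QuantumComplexity
  Literature.Computability.Complexity
open Summit.QuantumAdvantage.QuantumAdvantage.Theorems.WbwVerifiableLineNoSpeedup.Negative.PermInstances

variable {m T : ℕ}

/-- The prefix of the line is unchanged by a transposition at `x_k` with `v` off the prefix. [folklore] -/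
theorem pow_transpose_prefix {σ : Equiv.Perm (Fin (2 ^ m))} (h0 : NoReturnAtZero T σ) {k : ℕ}
    (hk : k ≤ T) {v : Fin (2 ^ m)} (hv : ∀ j ≤ k, (σ ^ j) (src0 m) ≠ v) :
    ∀ j ≤ k, ((transpose σ ((σ ^ k) (src0 m)) v) ^ j) (src0 m) = (σ ^ j) (src0 m) :=
  permLine_transpose_eq (prefix_ne_of_noReturnAtZero h0 hk) (fun j hj => hv j hj.le)

/-- **Uniform line formula.** If `σ` and `σ'' = σ * swap x_k v` (`k ≤ T`, `v ∉ {x_0,…,x_k}`) both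
have no return within `T` steps, then `x_{k+s}(σ'') = σ^s v` for `1 ≤ s ≤ T` — for merge AND split
partners alike (the orbit of `v` cannot come back to `x_k` within `T` steps, or `x_k` would return
to itself under `σ''`). [folklore] -/
theorem line_formula {σ : Equiv.Perm (Fin (2 ^ m))} (hσ : NoReturn T σ) {k : ℕ} (hk : k ≤ T)
    {v : Fin (2 ^ m)} (hv : ∀ j ≤ k, (σ ^ j) (src0 m) ≠ v)
    (hσ'' : NoReturn T (transpose σ ((σ ^ k) (src0 m)) v)) :
    ∀ s, 1 ≤ s → s ≤ T → ((transpose σ ((σ ^ k) (src0 m)) v) ^ (k + s)) (src0 m) = (σ ^ s) v := by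
  set u := (σ ^ k) (src0 m) with hu_def
  set τ := transpose σ u v with hτ
  have hu : ∀ j < k, (σ ^ j) (src0 m) ≠ (σ ^ k) (src0 m) := prefix_ne_of_noReturnAtZero hσ.atZero hk
  have hv' : ∀ j < k, (σ ^ j) (src0 m) ≠ v := fun j hj => hv j hj.le
  have hτk : (τ ^ k) (src0 m) = u := permLine_transpose_eq hu hv' k le_rfl
  -- induction on the range `s`
  have main : ∀ s ≤ T, ∀ s', 1 ≤ s' → s' ≤ s → (τ ^ (k + s')) (src0 m) = (σ ^ s') v := by
    intro s
    induction s with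
    | zero => intro _ s' h1 h2; omega
    | succ s ih =>
      intro hs s' h1 h2
      have ih' := ih (by omega)
      -- avoidance up to `s`
      have havoid : ∀ s'', 1 ≤ s'' → s'' ≤ s → (σ ^ s'') v ≠ u ∧ (σ ^ s'') v ≠ v := by
        intro s'' h1'' h2''
        refine ⟨fun heq => ?_, hσ v s'' h1'' (by omega)⟩
        -- σ^s'' v = u ⇒ τ^(k+s'') 0 = u = τ^k 0 ⇒ τ^s'' u = u
        have h3 := ih' s'' h1'' h2''
        rw [heq] at h3
        have : (τ ^ s'') u = u := by
          rw [← hτk, ← Equiv.Perm.mul_apply, ← pow_add, add_comm]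
          rw [hτk]; exact h3
        exact hσ'' u s'' h1'' (by omega) this
      exact permLine_transpose_add hu hv' havoid s' h1 h2
  intro s h1 h2
  exact main T le_rfl s h1 h2

/-- `Adj` is symmetric on permutations whose lines are simple. [folklore] -/
theorem adj_symm {σ σ' : Equiv.Perm (Fin (2 ^ m))} (h0 : NoReturnAtZero T σ) (h : Adj T σ σ') :
    Adj T σ' σ := by
  obtain ⟨k, hk, v, hv, rfl⟩ := h
  refine ⟨k, hk, v, ?_, ?_⟩
  · intro j hj
    rw [pow_transpose_prefix h0 hk.le hv j hj]
    exact hv j hj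
  · rw [pow_transpose_prefix h0 hk.le hv k le_rfl]
    exact (transpose_transpose σ _ v).symm

/-- The witness map of a pair: some `(k, v)` with `σ' = transpose σ x_k v`. [folklore] -/
theorem adj_choose {σ σ' : Equiv.Perm (Fin (2 ^ m))} (h : Adj T σ σ') :
    ∃ kv : Fin T × Fin (2 ^ m), (∀ j ≤ kv.1.val, (σ ^ j) (src0 m) ≠ kv.2) ∧
      σ' = transpose σ ((σ ^ kv.1.val) (src0 m)) kv.2 := by
  obtain ⟨k, hk, v, hv, rfl⟩ := h
  exact ⟨(⟨k, hk⟩, v), hv, rfl⟩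

/-- **Count: all partners of a left end are at most `T · 2^m`.** [folklore] -/
theorem card_partners_fst_le (σ : Equiv.Perm (Fin (2 ^ m))) :
    #((Rp m T).filter fun q => q.1 = σ) ≤ T * 2 ^ m := by
  classical
  -- inject into Fin T × Fin (2^m) via the chosen witness
  have key : ∀ q ∈ (Rp m T).filter (fun q => q.1 = σ), ∃ kv : Fin T × Fin (2 ^ m),
      q.2 = transpose σ ((σ ^ kv.1.val) (src0 m)) kv.2 := by
    intro q hq
    rw [Finset.mem_filter, mem_Rp_iff] at hq
    obtain ⟨⟨-, -, hadj⟩, rfl⟩ := hq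
    obtain ⟨kv, -, h⟩ := adj_choose hadj
    exact ⟨kv, h⟩
  rcases Nat.eq_zero_or_pos T with rfl | hTpos
  · rw [Rp_zero]; simp
  haveI : Nonempty (Fin T) := ⟨⟨0, hTpos⟩⟩
  choose! f hf using key
  calc #((Rp m T).filter fun q => q.1 = σ)
      ≤ #(Finset.univ : Finset (Fin T × Fin (2 ^ m))) := by
        refine Finset.card_le_card_of_injOn f (fun q _ => Finset.mem_univ _) ?_
        intro q hq q' hq' hqq'
        have h1 := hf q hq
        have h2 := hf q' hq'
        rw [Finset.mem_coe, Finset.mem_filter] at hq hq'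
        apply Prod.ext
        · rw [hq.2, hq'.2]
        · rw [h1, h2, hqq']
    _ = T * 2 ^ m := by simp

/-- The same for right ends (by symmetry of `Adj`). [folklore] -/
theorem card_partners_snd_le (σ' : Equiv.Perm (Fin (2 ^ m))) :
    #((Rp m T).filter fun q => q.2 = σ') ≤ T * 2 ^ m := by
  classical
  have key : ∀ q ∈ (Rp m T).filter (fun q => q.2 = σ'), ∃ kv : Fin T × Fin (2 ^ m),
      q.1 = transpose σ' ((σ' ^ kv.1.val) (src0 m)) kv.2 := by
    intro q hq
    rw [Finset.mem_filter, mem_Rp_iff] at hq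
    obtain ⟨⟨hx, -, hadj⟩, rfl⟩ := hq
    obtain ⟨kv, -, h⟩ := adj_choose (adj_symm (noReturn_of_mem_Xp hx).atZero hadj)
    exact ⟨kv, h⟩
  rcases Nat.eq_zero_or_pos T with rfl | hTpos
  · rw [Rp_zero]; simp
  haveI : Nonempty (Fin T) := ⟨⟨0, hTpos⟩⟩
  choose! f hf using key
  calc #((Rp m T).filter fun q => q.2 = σ')
      ≤ #(Finset.univ : Finset (Fin T × Fin (2 ^ m))) := by
        refine Finset.card_le_card_of_injOn f (fun q _ => Finset.mem_univ _) ?_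
        intro q hq q' hq' hqq'
        have h1 := hf q hq
        have h2 := hf q' hq'
        rw [Finset.mem_coe, Finset.mem_filter] at hq hq'
        apply Prod.ext
        · rw [h1, h2, hqq']
        · rw [hq.2, hq'.2]
    _ = T * 2 ^ m := by simp

/-- A transposed permutation differs from `σ` at row `a` only if `a ∈ {u, v}`. [folklore] -/
theorem mem_of_transpose_apply_ne {σ : Equiv.Perm (Fin (2 ^ m))} {u v a : Fin (2 ^ m)}
    (h : transpose σ u v a ≠ σ a) : a = u ∨ a = v := by
  by_contra hne
  push Not at hne
  exact h (transpose_apply_of_ne σ hne.1 hne.2)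

/-- **Count: partners of `σ` changing row `a` are at most `2^m + T`.** [folklore] -/
theorem card_partners_fst_row_le {σ : Equiv.Perm (Fin (2 ^ m))} (hσ : NoReturnAtZero T σ)
    (a : Fin (2 ^ m)) :
    #((Rp m T).filter fun q => q.1 = σ ∧ q.2 a ≠ σ a) ≤ 2 ^ m + T := by
  classical
  have key : ∀ q ∈ (Rp m T).filter (fun q => q.1 = σ ∧ q.2 a ≠ σ a), ∃ kv : Fin T × Fin (2 ^ m),
      q.2 = transpose σ ((σ ^ kv.1.val) (src0 m)) kv.2 ∧ (a = (σ ^ kv.1.val) (src0 m) ∨ a = kv.2) := by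
    intro q hq
    rw [Finset.mem_filter, mem_Rp_iff] at hq
    obtain ⟨⟨-, -, hadj⟩, rfl, ha⟩ := hq
    obtain ⟨kv, -, h⟩ := adj_choose hadj
    refine ⟨kv, h, ?_⟩
    rw [h] at ha
    exact mem_of_transpose_apply_ne ha
  rcases Nat.eq_zero_or_pos T with rfl | hTpos
  · rw [Rp_zero]; simp
  haveI : Nonempty (Fin T) := ⟨⟨0, hTpos⟩⟩
  choose! f hf using key
  -- target set: {(k, v) | a = x_k} ∪ {(k, v) | v = a}
  set S : Finset (Fin T × Fin (2 ^ m)) :=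
    Finset.univ.filter (fun kv => a = (σ ^ kv.1.val) (src0 m) ∨ a = kv.2) with hS
  calc #((Rp m T).filter fun q => q.1 = σ ∧ q.2 a ≠ σ a) ≤ #S := by
        refine Finset.card_le_card_of_injOn f (fun q hq => ?_) ?_
        · rw [Finset.mem_coe] at hq
          rw [hS, Finset.mem_coe, Finset.mem_filter]
          exact ⟨Finset.mem_univ _, (hf q hq).2⟩
        · intro q hq q' hq' hqq'
          have h1 := (hf q hq).1
          have h2 := (hf q' hq').1
          rw [Finset.mem_coe, Finset.mem_filter] at hq hq'
          apply Prod.ext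
          · rw [hq.2.1, hq'.2.1]
          · rw [h1, h2, hqq']
    _ ≤ #(Finset.univ.filter (fun kv : Fin T × Fin (2 ^ m) => a = (σ ^ kv.1.val) (src0 m))) +
        #(Finset.univ.filter (fun kv : Fin T × Fin (2 ^ m) => a = kv.2)) := by
        rw [hS, Finset.filter_or]
        exact Finset.card_union_le _ _
    _ ≤ 2 ^ m + T := by
        apply add_le_add
        · -- at most one `k` with `x_k = a`, times `2^m` values of `v`
          have hinj := permLine_injective hσ
          calc #(Finset.univ.filter (fun kv : Fin T × Fin (2 ^ m) => a = (σ ^ kv.1.val) (src0 m)))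
              ≤ #((Finset.univ.filter (fun k : Fin T => a = (σ ^ k.val) (src0 m))) ×ˢ
                  (Finset.univ : Finset (Fin (2 ^ m)))) := by
                refine Finset.card_le_card fun kv hkv => ?_
                rw [Finset.mem_filter] at hkv
                rw [Finset.mem_product, Finset.mem_filter]
                exact ⟨⟨Finset.mem_univ _, hkv.2⟩, Finset.mem_univ _⟩
            _ ≤ 1 * 2 ^ m := by
                rw [Finset.card_product, Finset.card_univ, Fintype.card_fin]
                apply Nat.mul_le_mul_right
                rw [Finset.card_le_one]
                intro k hk k' hk'
                rw [Finset.mem_filter] at hk hk'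
                have := hk.2.symm.trans hk'.2
                -- σ^k 0 = σ^k' 0 with k, k' < T ⇒ k = k'
                have h := hinj (a₁ := ⟨k.val, by omega⟩) (a₂ := ⟨k'.val, by omega⟩) this
                exact Fin.ext (Fin.mk.inj_iff.1 h)
            _ = 2 ^ m := one_mul _
        · calc #(Finset.univ.filter (fun kv : Fin T × Fin (2 ^ m) => a = kv.2))
              ≤ #((Finset.univ : Finset (Fin T)) ×ˢ ({a} : Finset (Fin (2 ^ m)))) := by
                refine Finset.card_le_card fun kv hkv => ?_
                rw [Finset.mem_filter] at hkv
                rw [Finset.mem_product, Finset.mem_singleton]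
                exact ⟨Finset.mem_univ _, hkv.2.symm⟩
            _ = T := by simp

/-- The same for right ends. [folklore] -/
theorem card_partners_snd_row_le {σ' : Equiv.Perm (Fin (2 ^ m))} (hσ' : NoReturnAtZero T σ')
    (a : Fin (2 ^ m)) :
    #((Rp m T).filter fun q => q.2 = σ' ∧ q.1 a ≠ σ' a) ≤ 2 ^ m + T := by
  classical
  have key : ∀ q ∈ (Rp m T).filter (fun q => q.2 = σ' ∧ q.1 a ≠ σ' a), ∃ kv : Fin T × Fin (2 ^ m),
      q.1 = transpose σ' ((σ' ^ kv.1.val) (src0 m)) kv.2 ∧ (a = (σ' ^ kv.1.val) (src0 m) ∨ a = kv.2) := by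
    intro q hq
    rw [Finset.mem_filter, mem_Rp_iff] at hq
    obtain ⟨⟨hx, -, hadj⟩, rfl, ha⟩ := hq
    obtain ⟨kv, -, h⟩ := adj_choose (adj_symm (noReturn_of_mem_Xp hx).atZero hadj)
    refine ⟨kv, h, ?_⟩
    rw [h] at ha
    exact mem_of_transpose_apply_ne ha
  rcases Nat.eq_zero_or_pos T with rfl | hTpos
  · rw [Rp_zero]; simp
  haveI : Nonempty (Fin T) := ⟨⟨0, hTpos⟩⟩
  choose! f hf using key
  set S : Finset (Fin T × Fin (2 ^ m)) :=
    Finset.univ.filter (fun kv => a = (σ' ^ kv.1.val) (src0 m) ∨ a = kv.2) with hS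
  calc #((Rp m T).filter fun q => q.2 = σ' ∧ q.1 a ≠ σ' a) ≤ #S := by
        refine Finset.card_le_card_of_injOn f (fun q hq => ?_) ?_
        · rw [Finset.mem_coe] at hq
          rw [hS, Finset.mem_coe, Finset.mem_filter]
          exact ⟨Finset.mem_univ _, (hf q hq).2⟩
        · intro q hq q' hq' hqq'
          have h1 := (hf q hq).1
          have h2 := (hf q' hq').1
          rw [Finset.mem_coe, Finset.mem_filter] at hq hq'
          apply Prod.ext
          · rw [h1, h2, hqq']
          · rw [hq.2.1, hq'.2.1]
    _ ≤ #(Finset.univ.filter (fun kv : Fin T × Fin (2 ^ m) => a = (σ' ^ kv.1.val) (src0 m))) +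
        #(Finset.univ.filter (fun kv : Fin T × Fin (2 ^ m) => a = kv.2)) := by
        rw [hS, Finset.filter_or]
        exact Finset.card_union_le _ _
    _ ≤ 2 ^ m + T := by
        apply add_le_add
        · have hinj := permLine_injective hσ'
          calc #(Finset.univ.filter (fun kv : Fin T × Fin (2 ^ m) => a = (σ' ^ kv.1.val) (src0 m)))
              ≤ #((Finset.univ.filter (fun k : Fin T => a = (σ' ^ k.val) (src0 m))) ×ˢ
                  (Finset.univ : Finset (Fin (2 ^ m)))) := by
                refine Finset.card_le_card fun kv hkv => ?_
                rw [Finset.mem_filter] at hkv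
                rw [Finset.mem_product, Finset.mem_filter]
                exact ⟨⟨Finset.mem_univ _, hkv.2⟩, Finset.mem_univ _⟩
            _ ≤ 1 * 2 ^ m := by
                rw [Finset.card_product, Finset.card_univ, Fintype.card_fin]
                apply Nat.mul_le_mul_right
                rw [Finset.card_le_one]
                intro k hk k' hk'
                rw [Finset.mem_filter] at hk hk'
                have := hk.2.symm.trans hk'.2
                have h := hinj (a₁ := ⟨k.val, by omega⟩) (a₂ := ⟨k'.val, by omega⟩) this
                exact Fin.ext (Fin.mk.inj_iff.1 h)
            _ = 2 ^ m := one_mul _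
        · calc #(Finset.univ.filter (fun kv : Fin T × Fin (2 ^ m) => a = kv.2))
              ≤ #((Finset.univ : Finset (Fin T)) ×ˢ ({a} : Finset (Fin (2 ^ m)))) := by
                refine Finset.card_le_card fun kv hkv => ?_
                rw [Finset.mem_filter] at hkv
                rw [Finset.mem_product, Finset.mem_singleton]
                exact ⟨Finset.mem_univ _, hkv.2.symm⟩
            _ = T := by simp


end Summit.QuantumAdvantage.QuantumAdvantage.Theorems.WbwVerifiableLineNoSpeedup.Negative.Adversary
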